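import Literature.NumberTheory.GaloisCohomology.Howard2004.InertRingClassTotallyRamifiedProofs
import HarnessLib

/-!
# `Gal(K̄/K[c])` is stable under conjugation by any lift of an automorphism of `K`; the local
# transports `φ_v` of a `ConjugationDatum` preserve `Γ_{K_v} ∩ Γ_{K[c]}` and Howard's `Γ_L`
# (proofs file)

Topic `NumberTheory/GaloisCohomology/Howard2004` (sequel to `InertRingClassTotallyRamifiedProofs` /
`TransverseConditionRingClassKernelProofs`).  THEOREMS ONLY: no definition, no named fact, no instance,
no `sorry`.

B. Howard, *The Heegner point Kolyvagin system*, Compositio Math. 140 (2004) §1.2–§1.3 (arXiv:1202.6340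
p. 6 L84–95, p. 7 L33–48): the transverse condition at a degree-two prime `λ` is cut out by the ring class
field `K[ℓ]`, and «conjugation by `τ` induces an isomorphism `H¹(K_λ̄, T) ≅ H¹(K_λ, Tw(T))`» which is to
respect the local conditions (H.4 / H.5(b)).  The Galois bookkeeping behind this is Cox, Lemma 9.3:
**the ring class field `K[c]` is Galois over `ℚ`**, i.e. `Γ_{K[c]} = Gal(K̄/K[c])` is normal in `Γ_K`
(the tree's `ringClassSubgroup_normal`) AND stable under conjugation by a lift of complex conjugation.
This file proves the second half for the tree's `ringClassSubgroup K c jbar` (cut out by `jbar : K̄ → ℂ`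
and the singular moduli of discriminant `c²d_K`) and draws the local consequences:

* §1 `exists_ringEquiv_apply_eq_ringEquiv_apply` — every ring automorphism `θ` of `K̄` is induced along
  `jbar` by an automorphism of `ℂ` (extension of `jbar ∘ θ ∘ jbar⁻¹` from the countable subfield
  `jbar(K̄)`); hence `ringEquiv_apply_mem_preimage_ringClassSingularModuli` — the `jbar`-preimages of the
  singular moduli of discriminant `c²d_K` are permuted by every `θ` (Cox (10.26),
  `ringEquiv_apply_mem_ringClassSingularModuli`) — and **`IsLiftOfAut.conjGalCMH_mem_ringClassSubgroup`**:
  for ANY lift `τ` to `K̄` of ANY automorphism `σ` of `K`, `g ∈ Γ_{K[c]} → τ⁻¹ g τ ∈ Γ_{K[c]}`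
  (with the `iff` and the `comap` equality).
* §2 For a `ConjugationDatum` `cd` (complex conjugation `τ` with local transports
  `φ_v : Γ_{K_v} → Γ_{K_v̄}`, `res ∘ φ_v = δ_v⁻¹ (τ⁻¹ · τ) δ_v ∘ res`): **`ConjugationDatum.φ_mem_localRingClassSubgroup`**
  — `h ∈ Γ_{K_v} ∩ Γ_{K[c]} → φ_v h ∈ Γ_{K_v̄} ∩ Γ_{K[c]}` (normality for `δ_v`, §1 for `τ`), the `iff`,
  and the same for Howard's `Γ_L` (`transverseFixer`, generated by the prime-to-`p` roots of
  `Γ_{K_λ} ∩ Γ_{K[ℓ]}`): `ConjugationDatum.φ_mem_transverseFixer`.  The first is VERBATIM the binder `hφ` of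
  `TransverseIsotropyProofs.ConjugationDatum.transportH1_mem_transverseCondition` (seat x9-p1-w4 g16).

Cell `pub/bsd-print-x9`, G87 = Howard 2004 Thm. 1.6.1 (print leaf `stub_h161` of stmt-BirchSwinnertonDyer-22642);
seat `bsd-line-x10b-p1-w6` g9, brick (RC-CONJ).  BSD is not proved by any of this.

References: [Howard2004HeegnerKolyvagin] §1.2–§1.3 (arXiv:1202.6340 p. 6 L84–95, p. 7 L33–48); [Cox2013] §9.A
Lemma 9.3, §10.C (10.26), §11.A Thm. 11.1; [GrossLMS1991] §3 (`K_n` Galois over `ℚ`, `τ`); [Lang2002] VIII §1.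
-/

set_option autoImplicit false

noncomputable section

open scoped Classical NumberField Cardinal
open NumberField IsDedekindDomain IsDedekindDomain.HeightOneSpectrum Field

/-! ## §1 `Γ_{K[c]}` is stable under conjugation by any lift of an automorphism of `K` -/

namespace Literature.NumberTheory.EllipticCurves

open Literature.NumberTheory.QuadraticFields.BinaryQuadraticForm (reducedForms)

variable {K : Type} [Field K] [NumberField K]

/-- The image `jbar(K̄) ⊆ ℂ` is countable (algebraic over `ℚ`). [folklore] -/
private theorem cardinalMk_fieldRange_le_aleph0' (jbar : AlgebraicClosure K →+* ℂ) :
    #jbar.fieldRange ≤ ℵ₀ := by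
  haveI : Algebra.IsAlgebraic ℚ jbar.fieldRange := by
    refine ⟨fun x ↦ ?_⟩
    obtain ⟨a, ha⟩ := jbar.mem_fieldRange.mp x.2
    haveI : Algebra.IsAlgebraic ℚ (AlgebraicClosure K) := Algebra.IsAlgebraic.trans ℚ K (AlgebraicClosure K)
    have h1 : IsAlgebraic ℚ (jbar a) :=
      (Algebra.IsAlgebraic.isAlgebraic (R := ℚ) a).algHom jbar.toRatAlgHom
    rw [ha] at h1
    exact (isAlgebraic_algebraMap_iff (R := ℚ) (A := ℂ) (S := jbar.fieldRange)
      (jbar.fieldRange.subtype.injective)).mp h1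
  exact Literature.FieldTheory.AlgClosed.Subfield.cardinalMk_le_aleph0_of_isAlgebraic _

/-- **Every ring automorphism `θ` of `K̄` is the restriction along `jbar : K̄ → ℂ` of an automorphism of
`ℂ`**: there is `θ̃ ∈ Aut(ℂ)` with `θ̃ (jbar a) = jbar (θ a)` for all `a` (extension of the embedding
`jbar ∘ θ ∘ jbar⁻¹` of the countable subfield `jbar(K̄)`; the tree's `exists_ringEquiv_apply_eq_smul` is the
case `θ ∈ Γ_K`). [cite: Lang2002, Ch. VIII §1 (extension of automorphisms to an algebraically closed overfield)] -/
theorem exists_ringEquiv_apply_eq_ringEquiv_apply (jbar : AlgebraicClosure K →+* ℂ)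
    (θ : AlgebraicClosure K ≃+* AlgebraicClosure K) :
    ∃ θC : ℂ ≃+* ℂ, ∀ a : AlgebraicClosure K, θC (jbar a) = jbar (θ a) := by
  let e : AlgebraicClosure K ≃+* jbar.fieldRange := jbar.rangeRestrictFieldEquiv
  let φ : jbar.fieldRange →+* ℂ := jbar.comp (θ.toRingHom.comp e.symm.toRingHom)
  obtain ⟨θC, hθC⟩ := Literature.FieldTheory.AlgClosed.Complex.exists_ringEquiv_apply_eq_of_subfield
    jbar.fieldRange (cardinalMk_fieldRange_le_aleph0' jbar) φ
  refine ⟨θC, fun a ↦ ?_⟩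
  have h := hθC (e a)
  have he : ((e a : jbar.fieldRange) : ℂ) = jbar a := rfl
  rw [he] at h
  rw [h]
  show jbar (θ (e.symm (e a))) = jbar (θ a)
  rw [e.symm_apply_apply]

/-- **The `jbar`-preimages of the singular moduli of discriminant `c²d_K` are permuted by every ring
automorphism `θ` of `K̄`** (`K` imaginary quadratic, `c ≠ 0`): if `jbar a = j(τ_Q)` for a reduced form `Q`
of discriminant `d_K c²` then so is `jbar (θ a)` — read `θ` through an automorphism of `ℂ` (§1) and use
Cox (10.26) (`ringEquiv_apply_mem_ringClassSingularModuli`). [cite: Cox2013, §10.C proof of Thm. 10.23, (10.26)] -/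
theorem ringEquiv_apply_mem_preimage_ringClassSingularModuli (hK : IsImaginaryQuadratic K)
    (jbar : AlgebraicClosure K →+* ℂ) {c : ℕ} (hc : c ≠ 0)
    (θ : AlgebraicClosure K ≃+* AlgebraicClosure K) {a : AlgebraicClosure K}
    (ha : jbar a ∈ (reducedForms (NumberField.discr K * (c : ℤ) ^ 2)).image formJ) :
    jbar (θ a) ∈ (reducedForms (NumberField.discr K * (c : ℤ) ^ 2)).image formJ := by
  obtain ⟨θC, hθC⟩ := exists_ringEquiv_apply_eq_ringEquiv_apply jbar θ
  have h1 : jbar a ∈ ringClassSingularModuli K c := by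
    simp only [ringClassSingularModuli]
    rwa [mul_comm] at ha
  have h2 := ringEquiv_apply_mem_ringClassSingularModuli hK θC hc h1
  rw [hθC] at h2
  simp only [ringClassSingularModuli] at h2
  rwa [mul_comm] at h2

/-- **`Γ_{K[c]}` is stable under conjugation by ANY lift `τ` of ANY automorphism `σ` of `K`**: for
`g ∈ ringClassSubgroup K c jbar`, `τ⁻¹ g τ ∈ ringClassSubgroup K c jbar` (`K` imaginary quadratic, `c ≠ 0`).
With `σ` = complex conjugation this is «`K[c]/ℚ` is Galois» (Cox Lemma 9.3 (i); Gross 1991 §3: `τ` acts on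
`K_n`); with `σ = 1` it is normality in `Γ_K` again.  Proof: `g` fixes the `jbar`-preimages `a` of the
singular moduli of discriminant `c²d_K` (definition of `ringClassSubgroup`), these are permuted by `τ`
(`ringEquiv_apply_mem_preimage_ringClassSingularModuli`), so `τ⁻¹ g τ a = τ⁻¹ τ a = a`.
[cite: Cox2013, §9.A Lemma 9.3 and §11.A Thm. 11.1] [cite: GrossLMS1991, §3 (τ on K_n)] -/
theorem IsLiftOfAut.conjGalCMH_mem_ringClassSubgroup {k : Type*} [Field k] [Algebra k K]
    {σ : K ≃ₐ[k] K} {τ : AlgebraicClosure K ≃+* AlgebraicClosure K} (hτ : IsLiftOfAut σ τ)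
    (hK : IsImaginaryQuadratic K) (jbar : AlgebraicClosure K →+* ℂ) {c : ℕ} (hc : c ≠ 0)
    {g : Field.absoluteGaloisGroup K} (hg : g ∈ ringClassSubgroup K c jbar) :
    hτ.conjGalCMH g ∈ ringClassSubgroup K c jbar := by
  simp only [ringClassSubgroup, Subgroup.mem_comap, Subgroup.mem_iInf, MulAction.mem_stabilizer_iff]
  intro a ha
  have hτa : jbar (τ a) ∈ (reducedForms (NumberField.discr K * (c : ℤ) ^ 2)).image formJ :=
    ringEquiv_apply_mem_preimage_ringClassSingularModuli hK jbar hc τ ha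
  have hfix : g • τ a = τ a := smul_eq_self_of_mem_ringClassSubgroup_of_mem_image hg hτa
  rw [Field.absoluteGaloisGroup.smul_def] at hfix
  change τ.symm ((Field.absoluteGaloisGroup.toAlgEquiv K g) (τ a)) = a
  rw [hfix, RingEquiv.symm_apply_apply]

/-- Conversely: if `τ⁻¹ g τ ∈ Γ_{K[c]}` then `g ∈ Γ_{K[c]}` (apply the preimage permutation to `τ⁻¹`).
[cite: Cox2013, §9.A Lemma 9.3 and §11.A Thm. 11.1] -/
theorem IsLiftOfAut.mem_ringClassSubgroup_of_conjGalCMH_mem {k : Type*} [Field k] [Algebra k K]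
    {σ : K ≃ₐ[k] K} {τ : AlgebraicClosure K ≃+* AlgebraicClosure K} (hτ : IsLiftOfAut σ τ)
    (hK : IsImaginaryQuadratic K) (jbar : AlgebraicClosure K →+* ℂ) {c : ℕ} (hc : c ≠ 0)
    {g : Field.absoluteGaloisGroup K} (hg : hτ.conjGalCMH g ∈ ringClassSubgroup K c jbar) :
    g ∈ ringClassSubgroup K c jbar := by
  simp only [ringClassSubgroup, Subgroup.mem_comap, Subgroup.mem_iInf, MulAction.mem_stabilizer_iff]
  intro a ha
  have hτa : jbar (τ.symm a) ∈ (reducedForms (NumberField.discr K * (c : ℤ) ^ 2)).image formJ :=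
    ringEquiv_apply_mem_preimage_ringClassSingularModuli hK jbar hc τ.symm ha
  have hfix : hτ.conjGalCMH g • τ.symm a = τ.symm a :=
    smul_eq_self_of_mem_ringClassSubgroup_of_mem_image hg hτa
  rw [Field.absoluteGaloisGroup.smul_def] at hfix
  change τ.symm ((Field.absoluteGaloisGroup.toAlgEquiv K g) (τ (τ.symm a))) = τ.symm a at hfix
  rw [RingEquiv.apply_symm_apply] at hfix
  have h := τ.symm.injective hfix
  change (Field.absoluteGaloisGroup.toAlgEquiv K g) a = a
  exact h

/-- `g ∈ Γ_{K[c]} ↔ τ⁻¹ g τ ∈ Γ_{K[c]}` for any lift `τ` of any automorphism of `K`.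
[cite: Cox2013, §9.A Lemma 9.3 and §11.A Thm. 11.1] -/
theorem IsLiftOfAut.conjGalCMH_mem_ringClassSubgroup_iff {k : Type*} [Field k] [Algebra k K]
    {σ : K ≃ₐ[k] K} {τ : AlgebraicClosure K ≃+* AlgebraicClosure K} (hτ : IsLiftOfAut σ τ)
    (hK : IsImaginaryQuadratic K) (jbar : AlgebraicClosure K →+* ℂ) {c : ℕ} (hc : c ≠ 0)
    (g : Field.absoluteGaloisGroup K) :
    hτ.conjGalCMH g ∈ ringClassSubgroup K c jbar ↔ g ∈ ringClassSubgroup K c jbar :=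
  ⟨hτ.mem_ringClassSubgroup_of_conjGalCMH_mem hK jbar hc, hτ.conjGalCMH_mem_ringClassSubgroup hK jbar hc⟩

/-- Subgroup form: the preimage of `Γ_{K[c]}` under `g ↦ τ⁻¹ g τ` is `Γ_{K[c]}`.
[cite: Cox2013, §9.A Lemma 9.3 and §11.A Thm. 11.1] -/
theorem IsLiftOfAut.comap_conjGalCMH_ringClassSubgroup {k : Type*} [Field k] [Algebra k K]
    {σ : K ≃ₐ[k] K} {τ : AlgebraicClosure K ≃+* AlgebraicClosure K} (hτ : IsLiftOfAut σ τ)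
    (hK : IsImaginaryQuadratic K) (jbar : AlgebraicClosure K →+* ℂ) {c : ℕ} (hc : c ≠ 0) :
    (ringClassSubgroup K c jbar).comap hτ.conjGalCMH.toMonoidHom = ringClassSubgroup K c jbar := by
  ext g
  rw [Subgroup.mem_comap]
  exact hτ.conjGalCMH_mem_ringClassSubgroup_iff hK jbar hc g

end Literature.NumberTheory.EllipticCurves

/-! ## §2 The local transports `φ_v` of a conjugation datum preserve `Γ_{K_v} ∩ Γ_{K[c]}` and `Γ_L` -/

namespace Literature.NumberTheory.GaloisCohomology.Howard2004

open Literature.NumberTheory.GaloisRepresentations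
open Literature.NumberTheory.EllipticCurves

variable {K : Type} [Field K] [NumberField K]

namespace ConjugationDatum

/-- **Conjugation by the datum's `τ` preserves `Γ_{K[c]}`**: `g ∈ ringClassSubgroup K c jbar →
cd.conj g ∈ ringClassSubgroup K c jbar` (§1 for the lift `cd.τ` of `cd.σ`).
[cite: Howard2004HeegnerKolyvagin, §1.3 (arXiv:1202.6340 p. 7 L33–41)] [cite: Cox2013, §9.A Lemma 9.3] -/
theorem conj_mem_ringClassSubgroup (cd : ConjugationDatum K) (hK : IsImaginaryQuadratic K)
    (jbar : AlgebraicClosure K →+* ℂ) {c : ℕ} (hc : c ≠ 0) {g : absoluteGaloisGroup K}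
    (hg : g ∈ ringClassSubgroup K c jbar) : cd.conj g ∈ ringClassSubgroup K c jbar :=
  cd.isLift.conjGalCMH_mem_ringClassSubgroup hK jbar hc hg

/-- `cd.conj g ∈ Γ_{K[c]} ↔ g ∈ Γ_{K[c]}`. [cite: Howard2004HeegnerKolyvagin, §1.3 (arXiv:1202.6340 p. 7 L33–41)] [cite: Cox2013, §9.A Lemma 9.3] -/
theorem conj_mem_ringClassSubgroup_iff (cd : ConjugationDatum K) (hK : IsImaginaryQuadratic K)
    (jbar : AlgebraicClosure K →+* ℂ) {c : ℕ} (hc : c ≠ 0) (g : absoluteGaloisGroup K) :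
    cd.conj g ∈ ringClassSubgroup K c jbar ↔ g ∈ ringClassSubgroup K c jbar :=
  cd.isLift.conjGalCMH_mem_ringClassSubgroup_iff hK jbar hc g

/-- **The local transport `φ_v : Γ_{K_v} → Γ_{K_v̄}` maps `Γ_{K_v} ∩ Γ_{K[c]}` into `Γ_{K_v̄} ∩ Γ_{K[c]}`**
(`K` imaginary quadratic, `c ≠ 0`): restricted to `K̄`, `φ_v h` is `δ_v⁻¹ (τ⁻¹ h τ) δ_v` (`cd.compat`), and
`Γ_{K[c]}` is normal in `Γ_K` (`ringClassSubgroup_normal`) and `τ`-stable (`conj_mem_ringClassSubgroup`).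
This is VERBATIM the binder `hφ` of `ConjugationDatum.transportH1_mem_transverseCondition`
(`TransverseIsotropyProofs`). [cite: Howard2004HeegnerKolyvagin, §1.2–§1.3 (arXiv:1202.6340 p. 6 L84–95, p. 7 L44–48)] [cite: Cox2013, §9.A Lemma 9.3] -/
theorem φ_mem_localRingClassSubgroup (cd : ConjugationDatum K) (hK : IsImaginaryQuadratic K)
    (jbar : AlgebraicClosure K →+* ℂ) {c : ℕ} (hc : c ≠ 0) (v : HeightOneSpectrum (𝓞 K))
    {h : absoluteGaloisGroup (v.adicCompletion K)} (hh : h ∈ localRingClassSubgroup c jbar v) :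
    cd.φ v h ∈ localRingClassSubgroup c jbar (cd.σ • v) := by
  simp only [localRingClassSubgroup, Subgroup.mem_comap] at hh ⊢
  change absGaloisRestrict K ((cd.σ • v).adicCompletion K) (cd.φ v h) ∈ ringClassSubgroup K c jbar
  rw [cd.compat]
  haveI := ringClassSubgroup_normal hK jbar hc
  have h1 : cd.conj (absGaloisRestrict K (v.adicCompletion K) h) ∈ ringClassSubgroup K c jbar :=
    cd.conj_mem_ringClassSubgroup hK jbar hc hh
  have h2 := Subgroup.Normal.conj_mem inferInstance _ h1 (cd.δ v)⁻¹
  rwa [inv_inv] at h2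

/-- `φ_v h ∈ Γ_{K_v̄} ∩ Γ_{K[c]} ↔ h ∈ Γ_{K_v} ∩ Γ_{K[c]}`. [cite: Howard2004HeegnerKolyvagin, §1.2–§1.3 (arXiv:1202.6340 p. 6 L84–95, p. 7 L44–48)] [cite: Cox2013, §9.A Lemma 9.3] -/
theorem φ_mem_localRingClassSubgroup_iff (cd : ConjugationDatum K) (hK : IsImaginaryQuadratic K)
    (jbar : AlgebraicClosure K →+* ℂ) {c : ℕ} (hc : c ≠ 0) (v : HeightOneSpectrum (𝓞 K))
    (h : absoluteGaloisGroup (v.adicCompletion K)) :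
    cd.φ v h ∈ localRingClassSubgroup c jbar (cd.σ • v) ↔ h ∈ localRingClassSubgroup c jbar v := by
  refine ⟨fun hh ↦ ?_, cd.φ_mem_localRingClassSubgroup hK jbar hc v⟩
  simp only [localRingClassSubgroup, Subgroup.mem_comap] at hh ⊢
  change absGaloisRestrict K ((cd.σ • v).adicCompletion K) (cd.φ v h) ∈ ringClassSubgroup K c jbar at hh
  rw [cd.compat] at hh
  haveI := ringClassSubgroup_normal hK jbar hc
  have h2 := Subgroup.Normal.conj_mem inferInstance _ hh (cd.δ v)
  rw [show cd.δ v * ((cd.δ v)⁻¹ * cd.conj (absGaloisRestrict K (v.adicCompletion K) h) * cd.δ v) *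
      (cd.δ v)⁻¹ = cd.conj (absGaloisRestrict K (v.adicCompletion K) h) by group] at h2
  exact (cd.conj_mem_ringClassSubgroup_iff hK jbar hc _).1 h2

/-- Subgroup form: `φ_v⁻¹ (Γ_{K_v̄} ∩ Γ_{K[c]}) = Γ_{K_v} ∩ Γ_{K[c]}`. [cite: Howard2004HeegnerKolyvagin, §1.2–§1.3 (arXiv:1202.6340 p. 6 L84–95, p. 7 L44–48)] -/
theorem comap_φ_localRingClassSubgroup (cd : ConjugationDatum K) (hK : IsImaginaryQuadratic K)
    (jbar : AlgebraicClosure K →+* ℂ) {c : ℕ} (hc : c ≠ 0) (v : HeightOneSpectrum (𝓞 K)) :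
    (localRingClassSubgroup c jbar (cd.σ • v)).comap (cd.φ v).toMonoidHom =
      localRingClassSubgroup c jbar v := by
  ext h
  rw [Subgroup.mem_comap]
  exact cd.φ_mem_localRingClassSubgroup_iff hK jbar hc v h

/-- **`φ_λ` maps Howard's `Γ_L ≤ Γ_{K_λ}` into the `Γ_L` of `λ̄`** (`transverseFixer`: generated by the
`σ` some prime-to-`p` power of which fixes `K[ℓ]`; `φ_λ` is a group homomorphism preserving
`Γ_{K_λ} ∩ Γ_{K[ℓ]}`). [cite: Howard2004HeegnerKolyvagin, §1.2 (arXiv:1202.6340 p. 6 L86–92)] -/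
theorem φ_mem_transverseFixer (cd : ConjugationDatum K) (hK : IsImaginaryQuadratic K)
    {p : ℕ} [Fact p.Prime] (jbar : AlgebraicClosure K →+* ℂ) {ℓ : ℕ} (hℓ : ℓ ≠ 0)
    (v : HeightOneSpectrum (𝓞 K)) {h : absoluteGaloisGroup (v.adicCompletion K)}
    (hh : h ∈ transverseFixer p ℓ jbar v) : cd.φ v h ∈ transverseFixer p ℓ jbar (cd.σ • v) := by
  have hmap : (transverseFixer p ℓ jbar v).map (cd.φ v).toMonoidHom ≤
      transverseFixer p ℓ jbar (cd.σ • v) := by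
    rw [transverseFixer, MonoidHom.map_closure]
    refine Subgroup.closure_mono ?_
    rintro _ ⟨x, ⟨k, hk, hxk⟩, rfl⟩
    refine ⟨k, hk, ?_⟩
    change (cd.φ v x) ^ k ∈ _
    rw [← map_pow]
    exact cd.φ_mem_localRingClassSubgroup hK jbar hℓ v hxk
  exact hmap ⟨h, hh, rfl⟩

/-- `φ_λ h ∈ Γ_L(λ̄) ↔ h ∈ Γ_L(λ)` (`φ_λ` is bijective, `φ_bijective`; apply the previous lemma to the
inverse isomorphism). [cite: Howard2004HeegnerKolyvagin, §1.2 (arXiv:1202.6340 p. 6 L86–92)] -/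
theorem φ_mem_transverseFixer_iff (cd : ConjugationDatum K) (hK : IsImaginaryQuadratic K)
    {p : ℕ} [Fact p.Prime] (jbar : AlgebraicClosure K →+* ℂ) {ℓ : ℕ} (hℓ : ℓ ≠ 0)
    (v : HeightOneSpectrum (𝓞 K)) (h : absoluteGaloisGroup (v.adicCompletion K)) :
    cd.φ v h ∈ transverseFixer p ℓ jbar (cd.σ • v) ↔ h ∈ transverseFixer p ℓ jbar v := by
  refine ⟨fun hh ↦ ?_, cd.φ_mem_transverseFixer hK jbar hℓ v⟩
  -- the inverse isomorphism `ψ = φ_v⁻¹` maps `Γ_L(λ̄)` into `Γ_L(λ)`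
  let E : absoluteGaloisGroup (v.adicCompletion K) ≃* absoluteGaloisGroup ((cd.σ • v).adicCompletion K) :=
    MulEquiv.ofBijective (cd.φ v).toMonoidHom (cd.φ_bijective v)
  have hE : ∀ x, E x = cd.φ v x := fun _ ↦ rfl
  have hmap : (transverseFixer p ℓ jbar (cd.σ • v)).map E.symm.toMonoidHom ≤ transverseFixer p ℓ jbar v := by
    rw [transverseFixer, MonoidHom.map_closure]
    refine Subgroup.closure_mono ?_
    rintro _ ⟨y, ⟨k, hk, hyk⟩, rfl⟩
    refine ⟨k, hk, ?_⟩
    change (E.symm y) ^ k ∈ _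
    rw [← (cd.φ_mem_localRingClassSubgroup_iff hK jbar hℓ v _), ← hE, map_pow, MulEquiv.apply_symm_apply]
    exact hyk
  have h1 : E.symm (cd.φ v h) ∈ transverseFixer p ℓ jbar v := hmap ⟨cd.φ v h, hh, rfl⟩
  rwa [← hE, MulEquiv.symm_apply_apply] at h1

end ConjugationDatum

end Literature.NumberTheory.GaloisCohomology.Howard2004

end
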